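import Mathlib
import Summits.KontsevichZagierPeriods.KontsevichZagierPeriods.Theorems.SoloInformedLegendreKernel
import Literature.NumberTheory.Transcendental.KZHomotopyMoves
import Literature.NumberTheory.Transcendental.KZSemialgebraicComplex
import Literature.NumberTheory.Transcendental.KZCubeProducts
import Literature.NumberTheory.Transcendental.KZProductIdeal
import Literature.NumberTheory.Transcendental.KZBallPeelingAux
import Literature.NumberTheory.Transcendental.KZSemiCanonicalReductionProofs
import HarnessLib
import HarnessLib.Audit

/-!
# Legendre's relation by moves, II: bands, domination and the boundary kill (solo-informed, s33)

Infrastructure for THEOREM XVII (Legendre's relation inside the Kontsevich–Zagier calculus):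

* the Legendre kernel `k = (1−s²)^{-1/2}(1−ms²)^{-1/2}(1−t²)^{-1/2}(1−m't²)^{-1/2}` (`m' = 1 − m`),
  read in any three coordinates `s = w i`, `t = w j`, `m = w l` of `ℝ³`, is `ℚ`-semialgebraic on
  every `ℚ`-semialgebraic set where `s, t ∈ (0,1)`, `0 ≤ m < 1`, and so are `p·k`, `p/q·k` for
  polynomials `p, q` (`soloInformed_legendre_sa_*`);
* an integrability-by-domination lemma on subsets of `ℝᴺ` that are the open cube up to a null
  set, the dominating function a sum of two cube Beta integrands
  (`soloInformed_integrableOn_of_le_cubeBeta`);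
* **the boundary kill** (`soloInformed_legendre_kill`): on the band
  `{(a, m, b) | a ∈ (0,1), 0 ≤ m ≤ μ, 0 ≤ b ≤ 1}` a fibre primitive `P` with `P(·,·,1) = P(·,·,0)`
  and fibre derivative `g` gives `[band, g] ∼ [base, 0] ∼ 0` by ONE Newton–Leibniz move (rule 3),
  after which the fibres are opened (rule 1a) and the coordinates permuted (rule 2, a
  permutation matrix); the output is a representation on the permuted open band with integrand
  `g ∘ perm` whose class is a relation.  This is the move that kills the exact form
  `d(A dt dm) + d(B ds dm)` of the certificate of file I.

References: M. Kontsevich, D. Zagier, *Periods* (2001), §1.2; this work (solo-informed s33).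
-/

noncomputable section

open MeasureTheory Set Filter
open scoped Classical

open Literature.NumberTheory.Transcendental Literature.NumberTheory.Transcendental.KZ
open Literature.ModelTheory.ExponentialFields

namespace Summit.KontsevichZagierPeriods.KontsevichZagierPeriods.Theorems

/-! ### Semialgebraicity of the Legendre kernel and its multiples -/

/-- `(√p)⁻¹` is `ℚ`-semialgebraic where the polynomial `p` is positive. [folklore] -/
theorem soloInformed_sa_inv_sqrt_aeval {n : ℕ} {S : Set (Fin n → ℝ)} (hS : IsSemialgebraic ℚ S)
    (p : MvPolynomial (Fin n) ℚ) (hp : ∀ w ∈ S, 0 < MvPolynomial.aeval w p) :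
    IsSemialgebraicFunOn ℚ S (fun w => (√(MvPolynomial.aeval w p))⁻¹) :=
  (IsSemialgebraicFunOn.sqrt_holds (isSemialgebraicFunOn_aeval hS p)).inv
    fun w hw => (Real.sqrt_pos.2 (hp w hw)).ne'

/-- The four radicands of the Legendre kernel are positive for `s, t ∈ [0,1)`, `m ∈ [0,1)`.
[this work] -/
theorem soloInformed_legendre_radicands_pos {s t m : ℝ} (hs : 0 ≤ s ∧ s < 1) (ht : 0 ≤ t ∧ t < 1)
    (hm : 0 ≤ m ∧ m < 1) :
    0 < 1 - s ^ 2 ∧ 0 < 1 - m * s ^ 2 ∧ 0 < 1 - t ^ 2 ∧ 0 < 1 - (1 - m) * t ^ 2 := by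
  have hs2 : s ^ 2 < 1 := by nlinarith
  have ht2 : t ^ 2 < 1 := by nlinarith
  refine ⟨by linarith, ?_, by linarith, ?_⟩
  · nlinarith [mul_le_mul_of_nonneg_right hm.2.le (sq_nonneg s)]
  · have : (1 - m) * t ^ 2 ≤ 1 * t ^ 2 :=
      mul_le_mul_of_nonneg_right (by linarith) (sq_nonneg t)
    linarith

/-- **The Legendre kernel is semialgebraic (open range).**  On a `ℚ`-semialgebraic `S ⊆ ℝ³` on
which `w i, w j ∈ [0,1)` and `w l ∈ [0,1)`, the kernel
`(√(1−wᵢ²))⁻¹(√(1−w_l wᵢ²))⁻¹((√(1−wⱼ²))⁻¹(√(1−(1−w_l)wⱼ²))⁻¹)` is `ℚ`-semialgebraic.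
[this work] -/
theorem soloInformed_legendre_sa_kernel (i j l : Fin 3) {S : Set (Fin 3 → ℝ)}
    (hS : IsSemialgebraic ℚ S)
    (hw : ∀ w ∈ S, (0 ≤ w i ∧ w i < 1) ∧ (0 ≤ w j ∧ w j < 1) ∧ 0 ≤ w l ∧ w l < 1) :
    IsSemialgebraicFunOn ℚ S (fun w => (√(1 - w i ^ 2))⁻¹ * (√(1 - w l * w i ^ 2))⁻¹ *
      ((√(1 - w j ^ 2))⁻¹ * (√(1 - (1 - w l) * w j ^ 2))⁻¹)) := by
  have h1 := soloInformed_sa_inv_sqrt_aeval hS (1 - MvPolynomial.X i ^ 2) fun w hwS => by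
    have := (soloInformed_legendre_radicands_pos (hw w hwS).1 (hw w hwS).2.1 (hw w hwS).2.2).1
    simpa only [map_sub, map_one, map_pow, map_mul, MvPolynomial.aeval_X] using this
  have h2 := soloInformed_sa_inv_sqrt_aeval hS (1 - MvPolynomial.X l * MvPolynomial.X i ^ 2)
    fun w hwS => by
    have := (soloInformed_legendre_radicands_pos (hw w hwS).1 (hw w hwS).2.1 (hw w hwS).2.2).2.1
    simpa only [map_sub, map_one, map_pow, map_mul, MvPolynomial.aeval_X] using this
  have h3 := soloInformed_sa_inv_sqrt_aeval hS (1 - MvPolynomial.X j ^ 2) fun w hwS => by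
    have := (soloInformed_legendre_radicands_pos (hw w hwS).1 (hw w hwS).2.1 (hw w hwS).2.2).2.2.1
    simpa only [map_sub, map_one, map_pow, map_mul, MvPolynomial.aeval_X] using this
  have h4 := soloInformed_sa_inv_sqrt_aeval hS
    (1 - (1 - MvPolynomial.X l) * MvPolynomial.X j ^ 2) fun w hwS => by
    have := (soloInformed_legendre_radicands_pos (hw w hwS).1 (hw w hwS).2.1 (hw w hwS).2.2).2.2.2
    simpa only [map_sub, map_one, map_pow, map_mul, MvPolynomial.aeval_X] using this
  refine (IsSemialgebraicFunOn.mul_holds (IsSemialgebraicFunOn.mul_holds h1 h2)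
    (IsSemialgebraicFunOn.mul_holds h3 h4)).congr fun w _ => ?_
  simp only [Pi.mul_apply, map_sub, map_one, map_pow, map_mul, MvPolynomial.aeval_X]

/-- **Multiples of the Legendre kernel are semialgebraic (closed range).**  On a
`ℚ`-semialgebraic `S ⊆ ℝ³` on which `w i, w j ∈ [0,1]` and `w l ∈ [0,1)`, every `R · k` with `R`
semialgebraic on `S` is semialgebraic: on the faces `w i = 1`, `w j = 1` the kernel is `0`
(`(√0)⁻¹ = 0`), elsewhere the open-range lemma applies; glue along the two pieces. [this work] -/
theorem soloInformed_legendre_sa_mul_kernel (i j l : Fin 3) {S : Set (Fin 3 → ℝ)}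
    (hS : IsSemialgebraic ℚ S)
    (hw : ∀ w ∈ S, (0 ≤ w i ∧ w i ≤ 1) ∧ (0 ≤ w j ∧ w j ≤ 1) ∧ 0 ≤ w l ∧ w l < 1)
    {R : (Fin 3 → ℝ) → ℝ} (hR : IsSemialgebraicFunOn ℚ S R) :
    IsSemialgebraicFunOn ℚ S (fun w => R w * ((√(1 - w i ^ 2))⁻¹ * (√(1 - w l * w i ^ 2))⁻¹ *
      ((√(1 - w j ^ 2))⁻¹ * (√(1 - (1 - w l) * w j ^ 2))⁻¹))) := by
  have hlt : ∀ i' : Fin 3, IsSemialgebraic ℚ {w : Fin 3 → ℝ | w i' < 1} := by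
    intro i'
    have h := isSemialgebraic_setOf_eval_pos (k := ℚ) (R := ℝ)
      (1 - MvPolynomial.X i' : MvPolynomial (Fin 3) ℚ)
    have hset : {x : Fin 3 → ℝ | 0 < MvPolynomial.aeval x
        (1 - MvPolynomial.X i' : MvPolynomial (Fin 3) ℚ)} = {w | w i' < 1} := by
      ext w
      simp only [mem_setOf_eq, map_sub, map_one, MvPolynomial.aeval_X, sub_pos]
    rw [hset] at h
    exact h
  have heq : ∀ i' : Fin 3, IsSemialgebraic ℚ {w : Fin 3 → ℝ | w i' = 1} := by
    intro i'
    have h := isSemialgebraic_setOf_eval_eq_zero (k := ℚ) (R := ℝ)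
      (MvPolynomial.X i' - 1 : MvPolynomial (Fin 3) ℚ)
    have hset : {x : Fin 3 → ℝ | MvPolynomial.aeval x
        (MvPolynomial.X i' - 1 : MvPolynomial (Fin 3) ℚ) = 0} = {w | w i' = 1} := by
      ext w
      simp only [mem_setOf_eq, map_sub, map_one, MvPolynomial.aeval_X, sub_eq_zero]
    rw [hset] at h
    exact h
  have hO : IsSemialgebraic ℚ ({w : Fin 3 → ℝ | w i < 1} ∩ {w | w j < 1}) :=
    (hlt i).inter (hlt j)
  have hZ : IsSemialgebraic ℚ ({w : Fin 3 → ℝ | w i = 1} ∪ {w | w j = 1}) :=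
    (heq i).union (heq j)
  have hS₁ := hS.inter hO
  have hS₂ := hS.inter hZ
  have h₁ : IsSemialgebraicFunOn ℚ (S ∩ ({w : Fin 3 → ℝ | w i < 1} ∩ {w | w j < 1}))
      (fun w => R w * ((√(1 - w i ^ 2))⁻¹ * (√(1 - w l * w i ^ 2))⁻¹ *
        ((√(1 - w j ^ 2))⁻¹ * (√(1 - (1 - w l) * w j ^ 2))⁻¹))) :=
    IsSemialgebraicFunOn.mul_holds (hR.mono inter_subset_left hS₁)
      (soloInformed_legendre_sa_kernel i j l hS₁ fun w hw' =>
        ⟨⟨(hw w hw'.1).1.1, hw'.2.1⟩, ⟨(hw w hw'.1).2.1.1, hw'.2.2⟩, (hw w hw'.1).2.2⟩)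
  have h₂ : IsSemialgebraicFunOn ℚ (S ∩ ({w : Fin 3 → ℝ | w i = 1} ∪ {w | w j = 1}))
      (fun _ => (0:ℝ)) := isSemialgebraicFunOn_const_of_isAlgebraic hS₂ isAlgebraic_zero
  have h := IsSemialgebraicFunOn.union h₁ h₂
    (F := fun w => R w * ((√(1 - w i ^ 2))⁻¹ * (√(1 - w l * w i ^ 2))⁻¹ *
        ((√(1 - w j ^ 2))⁻¹ * (√(1 - (1 - w l) * w j ^ 2))⁻¹)))
    (fun w _ => rfl) (fun w hw' => by
      rcases hw'.2 with h | h
      · simp only [mem_setOf_eq] at h; simp [h]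
      · simp only [mem_setOf_eq] at h; simp [h])
  have hS12 : S ∩ ({w : Fin 3 → ℝ | w i < 1} ∩ {w | w j < 1}) ∪
      S ∩ ({w : Fin 3 → ℝ | w i = 1} ∪ {w | w j = 1}) = S := by
    ext w
    simp only [mem_union, mem_inter_iff, mem_setOf_eq]
    constructor
    · rintro (⟨hw', -⟩ | ⟨hw', -⟩) <;> exact hw'
    · intro hwS
      rcases (hw w hwS).1.2.lt_or_eq with hi | hi
      · rcases (hw w hwS).2.1.2.lt_or_eq with hj | hj
        · exact Or.inl ⟨hwS, hi, hj⟩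
        · exact Or.inr ⟨hwS, Or.inr hj⟩
      · exact Or.inr ⟨hwS, Or.inl hi⟩
  rw [hS12] at h
  exact h

/-! ### Integrability by domination with sums of inverse-square-root products -/

/-- `∏_{j ∈ A} (√wⱼ)⁻¹ · ∏_{j ∈ B} (√(1−wⱼ))⁻¹` is absolutely integrable on the open unit cube
(a cube Beta integrand with exponents `½` and `1`). [folklore] -/
theorem soloInformed_integrableOn_inv_sqrt_prod {N : ℕ} (A B : Finset (Fin N)) :
    IntegrableOn (fun w : Fin N → ℝ => (∏ j ∈ A, (√(w j))⁻¹) * ∏ j ∈ B, (√(1 - w j))⁻¹)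
      {w : Fin N → ℝ | ∀ j, w j ∈ Ioo (0:ℝ) 1} := by
  have hQm : MeasurableSet {w : Fin N → ℝ | ∀ j, w j ∈ Ioo (0:ℝ) 1} :=
    IsSemialgebraic.measurableSet_holds (isSemialgebraic_box N)
  refine (integrableOn_cubeBetaIntegrand (fun j => if j ∈ A then (1/2 : ℚ) else 1)
    (fun j => if j ∈ B then (1/2 : ℚ) else 1) (fun j => ⟨by split_ifs <;> norm_num,
      by split_ifs <;> norm_num⟩)).congr_fun (fun w hw => ?_) hQm
  have hA : ∀ j, (w j) ^ (((if j ∈ A then (1/2 : ℚ) else 1 : ℚ) : ℝ) - 1) =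
      if j ∈ A then (√(w j))⁻¹ else 1 := by
    intro j
    split_ifs with h
    · exact (soloInformed_inv_sqrt_eq_rpow (hw j).1).symm
    · simp
  have hB : ∀ j, (1 - w j) ^ (((if j ∈ B then (1/2 : ℚ) else 1 : ℚ) : ℝ) - 1) =
      if j ∈ B then (√(1 - w j))⁻¹ else 1 := by
    intro j
    split_ifs with h
    · exact (soloInformed_inv_sqrt_eq_rpow (by linarith [(hw j).2])).symm
    · simp
  beta_reduce
  rw [Finset.prod_mul_distrib]
  simp_rw [hA, hB]
  rw [Finset.prod_ite_mem, Finset.prod_ite_mem, Finset.univ_inter, Finset.univ_inter]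

/-- **Domination lemma.**  Let `S ⊆ ℝᴺ` be `ℚ`-semialgebraic and contained in the open unit cube
up to a null set `Z`, and `G` a `ℚ`-semialgebraic function on `S` with
`|G| ≤ C · (Π_{A,B} + Π_{A',B'})` on `S ∩ (0,1)ᴺ`, where `Π_{A,B} = ∏_{A} (√wⱼ)⁻¹ ∏_{B} (√(1−wⱼ))⁻¹`.
Then `G` is absolutely integrable on `S`. [folklore] -/
theorem soloInformed_integrableOn_of_le_inv_sqrt_prod {N : ℕ} {S : Set (Fin N → ℝ)}
    (hS : IsSemialgebraic ℚ S) {G : (Fin N → ℝ) → ℝ} (hG : IsSemialgebraicFunOn ℚ S G)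
    (A B A' B' : Finset (Fin N)) (C : ℝ) (Z : Set (Fin N → ℝ)) (hZ : volume Z = 0)
    (hcube : ∀ w ∈ S, w ∉ Z → ∀ j, w j ∈ Ioo (0:ℝ) 1)
    (hle : ∀ w ∈ S, (∀ j, w j ∈ Ioo (0:ℝ) 1) →
      |G w| ≤ C * ((∏ j ∈ A, (√(w j))⁻¹) * (∏ j ∈ B, (√(1 - w j))⁻¹) +
        (∏ j ∈ A', (√(w j))⁻¹) * ∏ j ∈ B', (√(1 - w j))⁻¹)) :
    IntegrableOn G S := by
  have hSm : MeasurableSet S := IsSemialgebraic.measurableSet_holds hS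
  have hQm : MeasurableSet {w : Fin N → ℝ | ∀ j, w j ∈ Ioo (0:ℝ) 1} :=
    IsSemialgebraic.measurableSet_holds (isSemialgebraic_box N)
  set S' : Set (Fin N → ℝ) := S ∩ {w | ∀ j, w j ∈ Ioo (0:ℝ) 1} with hS'
  have hS'm : MeasurableSet S' := hSm.inter hQm
  -- the dominating function is integrable on the cube, hence on `S'`
  have hg0 : IntegrableOn (fun w : Fin N → ℝ =>
      C * ((∏ j ∈ A, (√(w j))⁻¹) * (∏ j ∈ B, (√(1 - w j))⁻¹) +
        (∏ j ∈ A', (√(w j))⁻¹) * ∏ j ∈ B', (√(1 - w j))⁻¹))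
      {w : Fin N → ℝ | ∀ j, w j ∈ Ioo (0:ℝ) 1} :=
    ((soloInformed_integrableOn_inv_sqrt_prod A B).add
      (soloInformed_integrableOn_inv_sqrt_prod A' B')).const_mul C
  have hg := hg0.mono_set (inter_subset_right : S' ⊆ _)
  -- `G` is measurable on `S`, hence on `S'`, and dominated there
  have hGm : AEStronglyMeasurable G (volume.restrict S') :=
    (aestronglyMeasurable_of_isSemialgebraicFunOn hG hSm).mono_measure
      (Measure.restrict_mono inter_subset_left le_rfl)
  have hGS' : IntegrableOn G S' := by
    refine Integrable.mono' hg hGm ?_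
    filter_upwards [ae_restrict_mem hS'm] with w hw
    rw [Real.norm_eq_abs]
    exact hle w hw.1 hw.2
  -- `S` and `S'` differ by a null set
  have hae : S =ᵐ[volume] S' := by
    refine (ae_eq_set).2 ⟨measure_mono_null (fun w hw => ?_) hZ, ?_⟩
    · by_contra hwZ
      exact hw.2 ⟨hw.1, hcube w hw.1 hwZ⟩
    · exact measure_mono_null (fun w hw => (hw.2 hw.1.1).elim) measure_empty
  exact hGS'.congr_set_ae hae

/-! ### The boundary kill -/

/-- **The boundary kill.**  Base `B' ⊆ ℝ²` `ℚ`-semialgebraic, band `B' × [0,1] ⊆ ℝ³` (fibre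
coordinate `b` last).  If `P` is `ℚ`-semialgebraic on the band, continuous on each closed fibre
with derivative `g` on the open fibre, `g` semialgebraic and absolutely integrable on the band, and
`P(·,·,1) = P(·,·,0)` on `B'`, then for every coordinate permutation `e` there is a representation
on `{w | w ∘ e ∈ B' × (0,1)}` with integrand `g(w ∘ e)` whose class lies in `KZ.relations`:
Newton–Leibniz (rule 3) gives `[band, g] ∼ [B', 0] ∼ 0`, opening the fibres is rule 1a,
permuting coordinates rule 2. [cite: KontsevichZagier2001, §1.2] [this work] -/
theorem soloInformed_legendre_kill (B' : Set (Fin 2 → ℝ)) (hB' : IsSemialgebraic ℚ B')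
    (P g : (Fin 3 → ℝ) → ℝ)
    (hP : IsSemialgebraicFunOn ℚ (KZlog.band B' (fun _ => 0) (fun _ => 1)) P)
    (hg : IsSemialgebraicFunOn ℚ (KZlog.band B' (fun _ => 0) (fun _ => 1)) g)
    (hcont : ∀ y ∈ B', ContinuousOn (fun b : ℝ => P (Fin.snoc y b)) (Icc 0 1))
    (hder : ∀ y ∈ B', ∀ b ∈ Ioo (0:ℝ) 1,
      HasDerivAt (fun b : ℝ => P (Fin.snoc y b)) (g (Fin.snoc y b)) b)
    (hint : IntegrableOn g (KZlog.band B' (fun _ => 0) (fun _ => 1)))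
    (h0 : ∀ y ∈ B', P (Fin.snoc y 1) - P (Fin.snoc y 0) = 0)
    (e : Equiv.Perm (Fin 3)) :
    ∃ T : IntegralRep 3,
      T.domain = {w | (fun i => w (e i)) ∈
        {u : Fin 3 → ℝ | Fin.init u ∈ B' ∧ 0 < u (Fin.last 2) ∧ u (Fin.last 2) < 1}} ∧
      (T.integrand = fun w => g (fun i => w (e i))) ∧ of T ∈ relations := by
  have hB'm : MeasurableSet B' := IsSemialgebraic.measurableSet_holds hB'
  have h0sa : IsSemialgebraicFunOn ℚ B' (fun _ => (0:ℝ)) :=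
    isSemialgebraicFunOn_const_of_isAlgebraic hB' isAlgebraic_zero
  have h1sa : IsSemialgebraicFunOn ℚ B' (fun _ => (1:ℝ)) :=
    isSemialgebraicFunOn_const_of_isAlgebraic hB' isAlgebraic_one
  -- the boundary function vanishes identically on the base
  have hds : IsSemialgebraicFunOn ℚ B' (fun y => P (Fin.snoc y ((fun _ => (1:ℝ)) y)) -
      P (Fin.snoc y ((fun _ => (0:ℝ)) y))) :=
    h0sa.congr fun y hy => (h0 y hy).symm
  have hdi : IntegrableOn (fun y => P (Fin.snoc y ((fun _ => (1:ℝ)) y)) -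
      P (Fin.snoc y ((fun _ => (0:ℝ)) y))) B' :=
    integrableOn_zero.congr_fun (fun y hy => (h0 y hy).symm) hB'm
  obtain ⟨rb, rd, hrbd, hrbi, hrdd, hrdi, hrel⟩ := exists_band_newtonLeibniz hB'
    (fun _ => 0) (fun _ => 1) h0sa h1sa (fun _ _ => zero_le_one) P g hP hg hcont hder hint hds hdi
  -- `[B', 0] ∼ 0`, hence `[band, g] ∼ 0`
  have hrd : of rd ∈ relations := by
    refine of_mem_relations_of_eqOn_zero rd fun y hy => ?_
    rw [hrdd] at hy
    simp only [hrdi, Pi.zero_apply]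
    exact h0 y hy
  have hrb : of rb ∈ relations := by
    have := relations.add_mem hrel hrd
    simpa using this
  -- open the fibres
  obtain ⟨r', hr'd, hr'i, hrel'⟩ := of_sub_of_restrict_openBand_mem_relations h0sa h1sa rb hrbd
  have hr' : of r' ∈ relations := by
    have := relations.sub_mem hrb hrel'
    simpa using this
  -- permute the coordinates
  have hre : of (r'.reindex e) ∈ relations := by
    have := relations.sub_mem hr' (of_sub_of_reindex_mem_relations r' e)
    simpa using this
  refine ⟨r'.reindex e, ?_, ?_, hre⟩
  · rw [IntegralRep.reindex_domain, hr'd]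
  · rw [IntegralRep.reindex_integrand, hr'i, hrbi]

/-- `(1 − s²)^{-1/2} ≤ (1 − s)^{-1/2}` on `(0,1)`. [folklore] -/
theorem soloInformed_inv_sqrt_one_sub_sq_le {s : ℝ} (hs : s ∈ Ioo (0:ℝ) 1) :
    (√(1 - s ^ 2))⁻¹ ≤ (√(1 - s))⁻¹ := by
  have h1 : 0 < 1 - s := by linarith [hs.2]
  have h2 : 1 - s ≤ 1 - s ^ 2 := by nlinarith [hs.1, hs.2]
  exact inv_anti₀ (Real.sqrt_pos.2 h1) (Real.sqrt_le_sqrt h2)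

end Summit.KontsevichZagierPeriods.KontsevichZagierPeriods.Theorems

end
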